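import Mathlib
import Summits.Ventures.HodgeRepro2.T5CMTypePlaces

/-!
# T5CMTypeGaloisDialect — a CM type of a Galois CM field, read as a set of Galois elements

Tier-5 support (seat p7, cell pub-hodge-repro2), sixth file of the embedding chain, closing the
reading that row 32 (`T5OrdinaryCMType`) and `T5EmbeddingTorsor.isOrdinary` left in prose: «the
elements of a CM type Σ read as elements of `Gal(E/ℚ)`, with `Σc = c • Σ` for the complex
conjugation `c`».  For a CM field `E` (Mathlib's `IsCMField`, complex conjugation
`IsCMField.complexConj E`) that is Galois over `ℚ`:

* `conjGal E : Gal(E/ℚ)` is complex conjugation; it is CENTRAL (`conjGal_comm`) and an involution;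
* `conjugate_eq_comp_conjGal`: the conjugate of a complex embedding `φ` is `φ ∘ c`;
* `galOfComplex_conjugate`: under the torsor identification `Hom(E, ℂ) ≃ Gal(E/ℚ)` of
  `T5CMTypePlaces`, conjugation of embeddings is left multiplication by `c`;
* **`isCMType_iff`**: `Σ ⊆ Hom(E, ℂ)` is a CM type (p1's `IsCMType`) iff its Galois image `T`
  satisfies `T ∩ cT = ∅` and `T ∪ cT = Gal(E/ℚ)` — exactly the hypotheses of
  `T5EmbeddingTorsor.isOrdinary` and of row 32's `isOrdinary_of_degree_one`;
* `isOrdinary_galImage`: the (ord) conclusion of `T5EmbeddingTorsor` for the Galois image of any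
  CM type.

Nothing about Hecke characters is asserted.
-/

namespace Summit.Ventures.HodgeRepro2.T5CMTypeGaloisDialect

open IsDedekindDomain NumberField T5DegreeOneEmbeddings T5EmbeddingPrimeEquiv T5EmbeddingTorsor
  T5CMTypePlaces
open scoped Pointwise

variable (E : Type*) [Field E] [NumberField E] [IsCMField E]

/-- Complex conjugation of the CM field `E` as an element of `Gal(E/ℚ)`. -/
noncomputable def conjGal : E ≃ₐ[ℚ] E := (IsCMField.complexConj E).restrictScalars ℚ

/-- `conjGal E x = complexConj E x`. -/
@[simp]
theorem conjGal_apply (x : E) : conjGal E x = IsCMField.complexConj E x := rfl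

variable {E}

/-- The conjugate of a complex embedding is its composite with complex conjugation. -/
theorem conjugate_eq_comp_conjGal (φ : E →+* ℂ) :
    ComplexEmbedding.conjugate φ = φ.comp (conjGal E).toAlgHom.toRingHom := by
  ext x
  simp [ComplexEmbedding.conjugate_coe_eq]

/-- Complex conjugation is central in `Gal(E/ℚ)` (it is the conjugation of EVERY complex
embedding, `IsCMField.complexEmbedding_complexConj`). -/
theorem conjGal_comm (σ : E ≃ₐ[ℚ] E) : σ * conjGal E = conjGal E * σ := by
  obtain ⟨φ⟩ : Nonempty (E →+* ℂ) := inferInstance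
  ext x
  apply φ.injective
  have h1 := IsCMField.complexEmbedding_complexConj E (φ.comp σ.toAlgHom.toRingHom) x
  have h2 := IsCMField.complexEmbedding_complexConj E φ (σ x)
  change φ (σ (IsCMField.complexConj E x)) = (starRingEnd ℂ) (φ (σ x)) at h1
  rw [AlgEquiv.mul_apply, AlgEquiv.mul_apply, conjGal_apply, conjGal_apply, h1, h2]

/-- Complex conjugation is an involution. -/
theorem conjGal_mul_self : conjGal E * conjGal E = 1 := by
  ext x
  simp [AlgEquiv.mul_apply, IsCMField.complexConj_apply_apply]

/-- `conjGal E` is its own inverse. -/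
theorem conjGal_inv : (conjGal E)⁻¹ = conjGal E :=
  inv_eq_of_mul_eq_one_right conjGal_mul_self

section torsor

variable [IsGalois ℚ E] (ιC : E →+* ℂ)

/-- Under the torsor identification, conjugation of embeddings is left multiplication by `c`. -/
theorem galOfComplex_conjugate (φ : E →+* ℂ) :
    galOfComplex ιC (ComplexEmbedding.conjugate φ) = conjGal E * galOfComplex ιC φ := by
  apply (compGalC_injective ιC)
  rw [compGalC_galOfComplex]
  conv_lhs => rw [← compGalC_galOfComplex ιC φ]
  rw [conjugate_eq_comp_conjGal, ← conjGal_comm]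
  rfl

/-- The Galois image of the conjugate type is `c • (Galois image)`. -/
theorem image_galOfComplex_conjType (Φ : Set (E →+* ℂ)) :
    galOfComplex ιC '' conjType Φ = conjGal E • (galOfComplex ιC '' Φ) := by
  ext σ
  constructor
  · rintro ⟨φ, ⟨ψ, hψ, rfl⟩, rfl⟩
    refine ⟨galOfComplex ιC ψ, ⟨ψ, hψ, rfl⟩, ?_⟩
    show conjGal E * galOfComplex ιC ψ = _
    rw [galOfComplex_conjugate]
  · rintro ⟨τ, ⟨ψ, hψ, rfl⟩, rfl⟩
    refine ⟨ComplexEmbedding.conjugate ψ, ⟨ψ, hψ, rfl⟩, ?_⟩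
    show _ = conjGal E * galOfComplex ιC ψ
    rw [galOfComplex_conjugate]

/-- **A CM type is exactly a Galois-dialect CM type**: `Σ ⊆ Hom(E, ℂ)` satisfies p1's `IsCMType`
iff its Galois image `T = galOfComplex ιC '' Σ` satisfies `T ∩ cT = ∅` and `T ∪ cT = Gal(E/ℚ)`. -/
theorem isCMType_iff (Φ : Set (E →+* ℂ)) :
    IsCMType E Φ ↔
      Disjoint (galOfComplex ιC '' Φ) (conjGal E • (galOfComplex ιC '' Φ)) ∧
        galOfComplex ιC '' Φ ∪ conjGal E • (galOfComplex ιC '' Φ) = Set.univ := by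
  rw [← image_galOfComplex_conjType, ← Set.image_union]
  constructor
  · intro hΦ
    refine ⟨(Set.disjoint_image_iff (galOfComplex ιC).injective).mpr
      (disjoint_conjType_of_isCMType hΦ), ?_⟩
    rw [union_conjType_of_isCMType hΦ, Set.image_univ, (galOfComplex ιC).range_eq_univ]
  · rintro ⟨hdisj, hcover⟩
    have hdisj' : Disjoint Φ (conjType Φ) :=
      (Set.disjoint_image_iff (galOfComplex ιC).injective).mp hdisj
    have hcover' : Φ ∪ conjType Φ = Set.univ := by
      apply (galOfComplex ιC).injective.image_injective
      rw [hcover, Set.image_univ, (galOfComplex ιC).range_eq_univ]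
    intro φ
    have hmem : φ ∈ Φ ∪ conjType Φ := by rw [hcover']; exact Set.mem_univ φ
    rcases hmem with h | h
    · left
      refine ⟨h, fun hc => ?_⟩
      exact Set.disjoint_left.mp hdisj' h ((mem_conjType_iff Φ φ).mpr hc)
    · right
      have h' : ComplexEmbedding.conjugate φ ∈ Φ := (mem_conjType_iff Φ φ).mp h
      refine ⟨h', fun hφ => ?_⟩
      exact Set.disjoint_left.mp hdisj' hφ h

/-- The (ord) conclusion of `T5EmbeddingTorsor.isOrdinary` for the Galois image of a CM type. -/
theorem isOrdinary_galImage {p : ℕ} [Fact p.Prime] (ι : E →+* ℚ_[p]) {Φ : Set (E →+* ℂ)}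
    (hΦ : IsCMType E Φ) :
    Disjoint (places ι (galOfComplex ιC '' Φ)) (places ι (conjGal E • (galOfComplex ιC '' Φ))) ∧
      places ι (galOfComplex ιC '' Φ) ∪ places ι (conjGal E • (galOfComplex ιC '' Φ)) =
        {w : HeightOneSpectrum (𝓞 E) | w.asIdeal.LiesOver (Ideal.span {(p : ℤ)})} :=
  let h := (isCMType_iff ιC Φ).mp hΦ
  isOrdinary ι (conjGal E) h.1 h.2

end torsor

end Summit.Ventures.HodgeRepro2.T5CMTypeGaloisDialect
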